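import Summits.QuantumFields.BalabanUV.Beta.EriceRemainderEnclosureHistoryAutonomyComparisonAgeCompositionFiveAgesFar
import Summits.QuantumFields.BalabanUV.Beta.EriceRemainderEnclosureHistoryAutonomyComparisonAgeCompositionFiveAgesOneBlockWidest
import Summits.QuantumFields.BalabanUV.Beta.EriceRemainderEnclosureHistoryAutonomyComparisonAgeCompositionOldTripleCapC2G
import Summits.QuantumFields.BalabanUV.Beta.EriceRemainderEnclosureHistoryAutonomyComparisonAgeCompositionOldTripleCapCG2
import Summits.QuantumFields.BalabanUV.Beta.EriceRemainderEnclosureHistoryAutonomyComparisonAgeCompositionOldTripleCapC3G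
import Summits.QuantumFields.BalabanUV.Beta.EriceRemainderEnclosureHistoryAutonomyComparisonAgeCompositionOldTripleCapCG3
import Summits.QuantumFields.BalabanUV.Beta.EriceRemainderEnclosureHistoryAutonomyComparisonAgeCompositionOldTripleCapC4G
import Summits.QuantumFields.BalabanUV.Beta.EriceRemainderEnclosureHistoryAutonomyComparisonAgeCompositionOldTripleCapCG4
import Summits.QuantumFields.BalabanUV.Beta.EriceRemainderEnclosureHistoryAutonomyComparisonAgeCompositionOldTripleCapC8G
import Summits.QuantumFields.BalabanUV.Beta.EriceRemainderEnclosureHistoryAutonomyComparisonAgeCompositionOldTripleCapCG8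

/-!
# EriceRemainderEnclosureHistoryAutonomyComparisonAgeCompositionFiveAgesFarWidest — (E104f) route (N), first order: THE CENSUS FIVE AGES FOR EVERY YOUNG SECOND AGE, a top ratio in `(8, 16]`.
# (E104e) for the cells with a ratio in `(8,16]`: `k₂ ≥ 30` by the three adaptive levels with the cell caps `0.85 … 0.96` (`20s∕(1−s) ≤ 114 … 480`), and
# the unions for EVERY `k₂ ≥ 2` with (E104c): **`flow_nonneg_census_five_ages_top8x16_every`** (`388k₂ ≤ k₃`, `k₄ ≤ 8k₃`, `k₅ ≤ 16k₄`),
# **`flow_nonneg_census_five_ages_top16x8_every`** (`493k₂ ≤ k₃`, `k₄ ≤ 16k₃`, `k₅ ≤ 8k₄`).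

Cell `pub-balaban`, β-function sub-cell, BINDER row D4 «RemainderConst leaves for Bałaban's split» (`HOME/BINDER-OWNERS.md`; owner lineage `b2b-balaban-beta-an4`;
this file by co-owner #2 lineage `b2b-balaban-beta-d4-p2`, generation 89), β-FLOW TEAM duty (1), FREEZE (0) honoured (def-free; nothing restated).

HONEST FRAMING (page 1, verbatim and binding).  *"Discharging BetaPertH makes Bałaban's UV stability UNCONDITIONAL — a real constructive-QFT result; it is
NOT the continuum limit and NOT the Clay problem."*  THIS FILE DISCHARGES NOTHING OF THE KIND.  Elementary real algebra ∕ real analysis about ABSTRACT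
functionals on a box ]0,γ]^ℕ with displayed floors, profiles and signs, and the FIRST-ORDER renewal objects of route (N) built from them — hypotheses of a
census, not facts; the form, signs, ages and moments of Bałaban's (1.22) limit functional are NOT PRINTED ([I] p. 298; GAPS G-t4-U2-1∕-2) and NOT asserted.
Row D4 class UNCHANGED (critical-path width 0; instance 0∕1; D4 DISCHARGE NO DATE).  HONEST DEPENDENCY: continuum YM on T⁴ ⇐ BetaPertH ∧ nine spine
estimates (0/9 proved); BetaPertH ⇐ (D1) ∧ (D4) ∧ CAP+tail; G-an2-4 gates asym, D1 and NE2/3/4.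

THE POINT (README `HOME/b2b-balaban-beta-d4-p2/g89/README.md` §4).  Uses (E104e) `flow_nonneg_census_five_ages_far_of_cap`, `…_top8_far`, (E104c) `…_top8x16 ∕ _top16x8`,
the (E103u–zb) cell tables BY NAME.  NOT CLAIMED: the cell `(8,16]²`; anything printed — NOT B12 Thm 2, NOT BetaPertH, NOT continuum, NOT Clay.

WHAT IS PROVED ([folklore]; 0 `def`, 0 sorry).  §1 `…_top8x16_far`, `…_top16x8_far`.  §2 **`…_top8x16_every`**, **`…_top16x8_every`**.
-/
noncomputable section
open Finset

namespace Summit.QuantumFields.BalabanUV.Beta.EriceRemainderEnclosureHistoryAutonomyComparisonAgeCompositionFiveAgesFarWidest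

open Literature.MathematicalPhysics.QuantumFieldTheory.Balaban1983to89
open Literature.MathematicalPhysics.QuantumFieldTheory.Balaban1983to89.T4BetaStationary
open Literature.MathematicalPhysics.QuantumFieldTheory.Balaban1983to89.T4BetaFlowWellPosed
open Summit.QuantumFields.BalabanUV.Beta.EriceRemainderEnclosureHistoryAutonomyComparisonAgeCompositionFiveAgesFar (top_closure_of_gap flow_nonneg_census_five_ages_far_of_cap flow_nonneg_census_five_ages_top8_far)
open Summit.QuantumFields.BalabanUV.Beta.EriceRemainderEnclosureHistoryAutonomyComparisonAgeCompositionFiveAgesOneBlockWidest (flow_nonneg_census_five_ages_top8x16 flow_nonneg_census_five_ages_top16x8)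
open Summit.QuantumFields.BalabanUV.Beta.EriceRemainderEnclosureHistoryAutonomyComparisonAgeCompositionOldTripleCapC2G (old_triple_load_le_c2g)
open Summit.QuantumFields.BalabanUV.Beta.EriceRemainderEnclosureHistoryAutonomyComparisonAgeCompositionOldTripleCapCG2 (old_triple_load_le_cg2)
open Summit.QuantumFields.BalabanUV.Beta.EriceRemainderEnclosureHistoryAutonomyComparisonAgeCompositionOldTripleCapC3G (old_triple_load_le_c3g)
open Summit.QuantumFields.BalabanUV.Beta.EriceRemainderEnclosureHistoryAutonomyComparisonAgeCompositionOldTripleCapCG3 (old_triple_load_le_cg3)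
open Summit.QuantumFields.BalabanUV.Beta.EriceRemainderEnclosureHistoryAutonomyComparisonAgeCompositionOldTripleCapC4G (old_triple_load_le_c4g)
open Summit.QuantumFields.BalabanUV.Beta.EriceRemainderEnclosureHistoryAutonomyComparisonAgeCompositionOldTripleCapCG4 (old_triple_load_le_cg4)
open Summit.QuantumFields.BalabanUV.Beta.EriceRemainderEnclosureHistoryAutonomyComparisonAgeCompositionOldTripleCapC8G (old_triple_load_le_c8g)
open Summit.QuantumFields.BalabanUV.Beta.EriceRemainderEnclosureHistoryAutonomyComparisonAgeCompositionOldTripleCapCG8 (old_triple_load_le_cg8)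

variable {B : (ℕ → ℝ) → ℝ} {γ b gIR : ℝ} {L : ℕ → ℝ} {K : ℕ} {h g : ℕ → ℝ}

/-! ## §1 `k₂ ≥ 30` -/

/-- **FIVE AGES, `k₂ ≥ 30`, `k₄ ≤ 8k₃`, `k₅ ≤ 16k₄`.**  `30 ≤ k₂`, `388k₂ ≤ k₃`, `k₃ < k₄ ≤ 8k₃`, `k₄ < k₅ ≤ 16k₄`, `k₅ < K`: `0 ≤ ε ≤ e` at every pin. [folklore] -/
theorem flow_nonneg_census_five_ages_top8x16_far
    (hmono : ∀ u v : ℕ → ℝ, SeqBox γ u → SeqBox γ v → (∀ j, u j ≤ v j) → B u ≤ B v)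
    (hL : ∀ k, 0 ≤ L k) (hb : 0 < b) (hlo : ∀ u, SeqBox γ u → b ≤ B u) (hdom : ∀ u, SeqBox γ u → ∑ k ∈ range K, L k * u k ≤ B u)
    (hh : SeqBox γ h) (hf : MemFlow B gIR h) (hg : ∀ t, 0 < g t ∧ g t ≤ 1)
    (hgF : ∀ t, 1 ≤ g t * (1 + ∑ k ∈ range K, L k * h (t + k) ^ 3 / 2))
    {k₂ k₃ k₄ k₅ : ℕ} (hk2 : 30 ≤ k₂) (hk3 : 388 * k₂ ≤ k₃)
    (h34l : k₃ < k₄) (h34h : k₄ ≤ 8 * k₃) (h45l : k₄ < k₅) (h45h : k₅ ≤ 16 * k₄) (hk5K : k₅ < K)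
    (hLa : ∀ l, l < K → l ≠ 1 → l ≠ k₂ → l ≠ k₃ → l ≠ k₄ → l ≠ k₅ → L l = 0)
    {N : ℕ} {KL : ℕ → ℕ → ℕ → ℝ}
    (hKL : ∀ k n l, KL k n l = if 0 < k ∧ k < K ∧ l < k then L k * h (n + k) ^ 3 / 2 * ∏ t ∈ Ico (n + 1 + l) (n + k + 1), g t else 0)
    {KA : ℕ → ℕ → ℕ → ℝ} {RA : ℕ → (ℕ → ℝ) → ℕ → ℝ}
    (hRA : ∀ i v m, RA i v m = ∑ l ∈ range K, KA i m l * v (m + 1 + l))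
    (hKA : ∀ i m l, KA i m l = KL i m l + KA (i + 1) m l) (hKAtop : ∀ m l, KA K m l = 0)
    {e ε : ℕ → ℝ} (he0 : ∀ m, 0 ≤ e m) (hea : ∀ m, e (m + 1) ≤ e m)
    (hεt : ∀ m, N < m → ε m = 0) (hεrec : ∀ m, ε m = e m - RA 1 ε m) : ∀ m, 0 ≤ ε m ∧ ε m ≤ e m := by
  rcases le_or_gt k₅ (8 * k₄) with hb' | hb'
  · exact flow_nonneg_census_five_ages_top8_far hmono hL hb hlo hdom hh hf hg hgF hk2 (by omega) h34l h34h h45l hb' hk5K hLa hKL hRA hKA hKAtop he0 hea hεt hεrec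
  rcases le_or_gt k₄ (2 * k₃) with h2 | h2
  · exact flow_nonneg_census_five_ages_far_of_cap hmono hL hb hlo hdom hh hf hg hgF hk2 (by omega) (by omega) (by omega) hk5K
        (s := 17 / 20) (by norm_num) (top_closure_of_gap (R := 114) (by norm_num) (by norm_num) (by omega))
        (fun q => old_triple_load_le_c2g hmono hL hb hlo hdom hh hf (by omega) (by omega) h2 hb' h45h hk5K q) hLa hKL hRA hKA hKAtop he0 hea hεt hεrec
  rcases le_or_gt k₄ (3 * k₃) with h3 | h3
  · exact flow_nonneg_census_five_ages_far_of_cap hmono hL hb hlo hdom hh hf hg hgF hk2 (by omega) (by omega) (by omega) hk5K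
        (s := 43 / 50) (by norm_num) (top_closure_of_gap (R := 123) (by norm_num) (by norm_num) (by omega))
        (fun q => old_triple_load_le_c3g hmono hL hb hlo hdom hh hf (by omega) h2 h3 hb' h45h hk5K q) hLa hKL hRA hKA hKAtop he0 hea hεt hεrec
  rcases le_or_gt k₄ (4 * k₃) with h4 | h4
  · exact flow_nonneg_census_five_ages_far_of_cap hmono hL hb hlo hdom hh hf hg hgF hk2 (by omega) (by omega) (by omega) hk5K
        (s := 22 / 25) (by norm_num) (top_closure_of_gap (R := 147) (by norm_num) (by norm_num) (by omega))
        (fun q => old_triple_load_le_c4g hmono hL hb hlo hdom hh hf (by omega) h3 h4 hb' h45h hk5K q) hLa hKL hRA hKA hKAtop he0 hea hεt hεrec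
  · exact flow_nonneg_census_five_ages_far_of_cap hmono hL hb hlo hdom hh hf hg hgF hk2 (by omega) (by omega) (by omega) hk5K
        (s := 19 / 20) (by norm_num) (top_closure_of_gap (R := 380) (by norm_num) (by norm_num) (by omega))
        (fun q => old_triple_load_le_c8g hmono hL hb hlo hdom hh hf (by omega) h4 h34h hb' h45h hk5K q) hLa hKL hRA hKA hKAtop he0 hea hεt hεrec

/-- **FIVE AGES, `k₂ ≥ 30`, `k₄ ≤ 16k₃`, `k₅ ≤ 8k₄`.**  `30 ≤ k₂`, `493k₂ ≤ k₃`, `k₃ < k₄ ≤ 16k₃`, `k₄ < k₅ ≤ 8k₄`, `k₅ < K`: `0 ≤ ε ≤ e` at every pin. [folklore] -/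
theorem flow_nonneg_census_five_ages_top16x8_far
    (hmono : ∀ u v : ℕ → ℝ, SeqBox γ u → SeqBox γ v → (∀ j, u j ≤ v j) → B u ≤ B v)
    (hL : ∀ k, 0 ≤ L k) (hb : 0 < b) (hlo : ∀ u, SeqBox γ u → b ≤ B u) (hdom : ∀ u, SeqBox γ u → ∑ k ∈ range K, L k * u k ≤ B u)
    (hh : SeqBox γ h) (hf : MemFlow B gIR h) (hg : ∀ t, 0 < g t ∧ g t ≤ 1)
    (hgF : ∀ t, 1 ≤ g t * (1 + ∑ k ∈ range K, L k * h (t + k) ^ 3 / 2))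
    {k₂ k₃ k₄ k₅ : ℕ} (hk2 : 30 ≤ k₂) (hk3 : 493 * k₂ ≤ k₃)
    (h34l : k₃ < k₄) (h34h : k₄ ≤ 16 * k₃) (h45l : k₄ < k₅) (h45h : k₅ ≤ 8 * k₄) (hk5K : k₅ < K)
    (hLa : ∀ l, l < K → l ≠ 1 → l ≠ k₂ → l ≠ k₃ → l ≠ k₄ → l ≠ k₅ → L l = 0)
    {N : ℕ} {KL : ℕ → ℕ → ℕ → ℝ}
    (hKL : ∀ k n l, KL k n l = if 0 < k ∧ k < K ∧ l < k then L k * h (n + k) ^ 3 / 2 * ∏ t ∈ Ico (n + 1 + l) (n + k + 1), g t else 0)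
    {KA : ℕ → ℕ → ℕ → ℝ} {RA : ℕ → (ℕ → ℝ) → ℕ → ℝ}
    (hRA : ∀ i v m, RA i v m = ∑ l ∈ range K, KA i m l * v (m + 1 + l))
    (hKA : ∀ i m l, KA i m l = KL i m l + KA (i + 1) m l) (hKAtop : ∀ m l, KA K m l = 0)
    {e ε : ℕ → ℝ} (he0 : ∀ m, 0 ≤ e m) (hea : ∀ m, e (m + 1) ≤ e m)
    (hεt : ∀ m, N < m → ε m = 0) (hεrec : ∀ m, ε m = e m - RA 1 ε m) : ∀ m, 0 ≤ ε m ∧ ε m ≤ e m := by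
  rcases le_or_gt k₄ (8 * k₃) with ha | ha
  · exact flow_nonneg_census_five_ages_top8_far hmono hL hb hlo hdom hh hf hg hgF hk2 (by omega) h34l ha h45l h45h hk5K hLa hKL hRA hKA hKAtop he0 hea hεt hεrec
  rcases le_or_gt k₅ (2 * k₄) with h2 | h2
  · exact flow_nonneg_census_five_ages_far_of_cap hmono hL hb hlo hdom hh hf hg hgF hk2 (by omega) (by omega) (by omega) hk5K
        (s := 43 / 50) (by norm_num) (top_closure_of_gap (R := 123) (by norm_num) (by norm_num) (by omega))
        (fun q => old_triple_load_le_cg2 hmono hL hb hlo hdom hh hf (by omega) ha h34h (by omega) h2 hk5K q) hLa hKL hRA hKA hKAtop he0 hea hεt hεrec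
  rcases le_or_gt k₅ (3 * k₄) with h3 | h3
  · exact flow_nonneg_census_five_ages_far_of_cap hmono hL hb hlo hdom hh hf hg hgF hk2 (by omega) (by omega) (by omega) hk5K
        (s := 22 / 25) (by norm_num) (top_closure_of_gap (R := 147) (by norm_num) (by norm_num) (by omega))
        (fun q => old_triple_load_le_cg3 hmono hL hb hlo hdom hh hf (by omega) ha h34h h2 h3 hk5K q) hLa hKL hRA hKA hKAtop he0 hea hεt hεrec
  rcases le_or_gt k₅ (4 * k₄) with h4 | h4
  · exact flow_nonneg_census_five_ages_far_of_cap hmono hL hb hlo hdom hh hf hg hgF hk2 (by omega) (by omega) (by omega) hk5K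
        (s := 89 / 100) (by norm_num) (top_closure_of_gap (R := 162) (by norm_num) (by norm_num) (by omega))
        (fun q => old_triple_load_le_cg4 hmono hL hb hlo hdom hh hf (by omega) ha h34h h3 h4 hk5K q) hLa hKL hRA hKA hKAtop he0 hea hεt hεrec
  · exact flow_nonneg_census_five_ages_far_of_cap hmono hL hb hlo hdom hh hf hg hgF hk2 (by omega) (by omega) (by omega) hk5K
        (s := 24 / 25) (by norm_num) (top_closure_of_gap (R := 480) (by norm_num) (by norm_num) (by omega))
        (fun q => old_triple_load_le_cg8 hmono hL hb hlo hdom hh hf (by omega) ha h34h h4 h45h hk5K q) hLa hKL hRA hKA hKAtop he0 hea hεt hεrec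

/-! ## §2 Every young second age -/

/-- **THE CENSUS FIVE AGES FOR EVERY `k₂ ≥ 2`, `k₄ ≤ 8k₃`, `k₅ ≤ 16k₄`.**  `2 ≤ k₂`, `388k₂ ≤ k₃`, `k₃ < k₄ ≤ 8k₃`, `k₄ < k₅ ≤ 16k₄`, `k₅ < K`: `0 ≤ ε ≤ e` at every
pin, every horizon, every damping of the self-consistent class. [folklore] -/
theorem flow_nonneg_census_five_ages_top8x16_every
    (hmono : ∀ u v : ℕ → ℝ, SeqBox γ u → SeqBox γ v → (∀ j, u j ≤ v j) → B u ≤ B v)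
    (hL : ∀ k, 0 ≤ L k) (hb : 0 < b) (hlo : ∀ u, SeqBox γ u → b ≤ B u) (hdom : ∀ u, SeqBox γ u → ∑ k ∈ range K, L k * u k ≤ B u)
    (hh : SeqBox γ h) (hf : MemFlow B gIR h) (hg : ∀ t, 0 < g t ∧ g t ≤ 1)
    (hgF : ∀ t, 1 ≤ g t * (1 + ∑ k ∈ range K, L k * h (t + k) ^ 3 / 2))
    {k₂ k₃ k₄ k₅ : ℕ} (hk2 : 2 ≤ k₂) (hk3 : 388 * k₂ ≤ k₃)
    (h34l : k₃ < k₄) (h34h : k₄ ≤ 8 * k₃) (h45l : k₄ < k₅) (h45h : k₅ ≤ 16 * k₄) (hk5K : k₅ < K)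
    (hLa : ∀ l, l < K → l ≠ 1 → l ≠ k₂ → l ≠ k₃ → l ≠ k₄ → l ≠ k₅ → L l = 0)
    {N : ℕ} {KL : ℕ → ℕ → ℕ → ℝ}
    (hKL : ∀ k n l, KL k n l = if 0 < k ∧ k < K ∧ l < k then L k * h (n + k) ^ 3 / 2 * ∏ t ∈ Ico (n + 1 + l) (n + k + 1), g t else 0)
    {KA : ℕ → ℕ → ℕ → ℝ} {RA : ℕ → (ℕ → ℝ) → ℕ → ℝ}
    (hRA : ∀ i v m, RA i v m = ∑ l ∈ range K, KA i m l * v (m + 1 + l))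
    (hKA : ∀ i m l, KA i m l = KL i m l + KA (i + 1) m l) (hKAtop : ∀ m l, KA K m l = 0)
    {e ε : ℕ → ℝ} (he0 : ∀ m, 0 ≤ e m) (hea : ∀ m, e (m + 1) ≤ e m)
    (hεt : ∀ m, N < m → ε m = 0) (hεrec : ∀ m, ε m = e m - RA 1 ε m) : ∀ m, 0 ≤ ε m ∧ ε m ≤ e m := by
  rcases le_or_gt k₂ 29 with h29 | h30
  · exact flow_nonneg_census_five_ages_top8x16 hmono hL hb hlo hdom hh hf hg hgF hk2 h29 hk3 h34l h34h h45l h45h hk5K hLa hKL hRA hKA hKAtop he0 hea hεt hεrec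
  · exact flow_nonneg_census_five_ages_top8x16_far hmono hL hb hlo hdom hh hf hg hgF (by omega) hk3 h34l h34h h45l h45h hk5K hLa hKL hRA hKA hKAtop he0 hea hεt hεrec

/-- **THE CENSUS FIVE AGES FOR EVERY `k₂ ≥ 2`, `k₄ ≤ 16k₃`, `k₅ ≤ 8k₄`.**  `2 ≤ k₂`, `493k₂ ≤ k₃`, `k₃ < k₄ ≤ 16k₃`, `k₄ < k₅ ≤ 8k₄`, `k₅ < K`: `0 ≤ ε ≤ e` at every
pin, every horizon, every damping of the self-consistent class. [folklore] -/
theorem flow_nonneg_census_five_ages_top16x8_every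
    (hmono : ∀ u v : ℕ → ℝ, SeqBox γ u → SeqBox γ v → (∀ j, u j ≤ v j) → B u ≤ B v)
    (hL : ∀ k, 0 ≤ L k) (hb : 0 < b) (hlo : ∀ u, SeqBox γ u → b ≤ B u) (hdom : ∀ u, SeqBox γ u → ∑ k ∈ range K, L k * u k ≤ B u)
    (hh : SeqBox γ h) (hf : MemFlow B gIR h) (hg : ∀ t, 0 < g t ∧ g t ≤ 1)
    (hgF : ∀ t, 1 ≤ g t * (1 + ∑ k ∈ range K, L k * h (t + k) ^ 3 / 2))
    {k₂ k₃ k₄ k₅ : ℕ} (hk2 : 2 ≤ k₂) (hk3 : 493 * k₂ ≤ k₃)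
    (h34l : k₃ < k₄) (h34h : k₄ ≤ 16 * k₃) (h45l : k₄ < k₅) (h45h : k₅ ≤ 8 * k₄) (hk5K : k₅ < K)
    (hLa : ∀ l, l < K → l ≠ 1 → l ≠ k₂ → l ≠ k₃ → l ≠ k₄ → l ≠ k₅ → L l = 0)
    {N : ℕ} {KL : ℕ → ℕ → ℕ → ℝ}
    (hKL : ∀ k n l, KL k n l = if 0 < k ∧ k < K ∧ l < k then L k * h (n + k) ^ 3 / 2 * ∏ t ∈ Ico (n + 1 + l) (n + k + 1), g t else 0)
    {KA : ℕ → ℕ → ℕ → ℝ} {RA : ℕ → (ℕ → ℝ) → ℕ → ℝ}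
    (hRA : ∀ i v m, RA i v m = ∑ l ∈ range K, KA i m l * v (m + 1 + l))
    (hKA : ∀ i m l, KA i m l = KL i m l + KA (i + 1) m l) (hKAtop : ∀ m l, KA K m l = 0)
    {e ε : ℕ → ℝ} (he0 : ∀ m, 0 ≤ e m) (hea : ∀ m, e (m + 1) ≤ e m)
    (hεt : ∀ m, N < m → ε m = 0) (hεrec : ∀ m, ε m = e m - RA 1 ε m) : ∀ m, 0 ≤ ε m ∧ ε m ≤ e m := by
  rcases le_or_gt k₂ 29 with h29 | h30
  · exact flow_nonneg_census_five_ages_top16x8 hmono hL hb hlo hdom hh hf hg hgF hk2 h29 hk3 h34l h34h h45l h45h hk5K hLa hKL hRA hKA hKAtop he0 hea hεt hεrec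
  · exact flow_nonneg_census_five_ages_top16x8_far hmono hL hb hlo hdom hh hf hg hgF (by omega) hk3 h34l h34h h45l h45h hk5K hLa hKL hRA hKA hKAtop he0 hea hεt hεrec

end Summit.QuantumFields.BalabanUV.Beta.EriceRemainderEnclosureHistoryAutonomyComparisonAgeCompositionFiveAgesFarWidest
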